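import Literature.Analysis.Complex.WindingCertificateCount
import HarnessLib

/-!
# Anchored winding certificates: zero counts from sampled pieces of `∂K` in arbitrary half-planes

Trunk T-ANA (`Literature/Analysis/Complex`). Companion of `WindingCertificate.lean` (quarter-plane labels)
and `WindingCertificateCount.lean` (exact counts from the value of `∮_{∂K} f'/f`, `K = [a,b] × [c,d]`).
This is the form in which a validated Taylor-model sweep along an edge delivers its data: on the piece
starting at the sample `zₖ` one certifies the step rule `|f(z) − f(zₖ)| < |f(zₖ)|`, i.e. `Re (f(z)/cₖ) > 0`
with the ANCHOR `cₖ = f(zₖ)` (any `cₖ ≠ 0` with this property will do; the labels `d` of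
`WindingCertificate.lean` are the anchors `i^d`: `qrot d · w = w / i^d`).

* `Literature.Analysis.Complex.anchorJump c c' = log (c'/c)`; JUNCTION IDENTITY
  `Literature.Analysis.Complex.log_div_sub_log_div_of_re_pos`: `log (w/c) − log (w/c') = log (c'/c)` when
  `Re (w/c) > 0`, `Re (w/c') > 0`.
* `Literature.Analysis.Complex.HAPieces f y x₀ L`, `VAPieces f x y₀ L` — validity of an anchored piece list
  `L : List (ℝ × ℂ)` (next endpoint, anchor) along a horizontal / vertical segment; exact edge integrals.
* `Literature.Analysis.Complex.rectBoundaryIntegral_logDeriv_eq_anchorSum`: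
  `∮_{∂K} f'/f = certAnchorSum … = Σ_{junctions, counter-clockwise} log (c_next/c_prev)` — a number depending
  on the ANCHORS ONLY (`2πi ·` the winding number about `0` of the closed polygon of anchors).
* Consequences (`a < b`, `c < d`): `Re (certAnchorSum …) = 0`, `Im (certAnchorSum …) = 2π · Σ m(ρ)` over the
  zeros of the open rectangle (`Literature.Analysis.Complex.exists_count_of_anchored_certificate`); `Im < 2π ⇒`
  zero-free (`Literature.Analysis.Complex.no_zero_of_anchored_certificate`); `Im ≠ 0 ⇒` a zero
  (`Literature.Analysis.Complex.exists_zero_of_anchored_certificate`); **`Im < 4π` and a known zero `ρ₀ ∈ K° ⇒`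
  `ρ₀` is the only zero in `K°` and `analyticOrderAt f ρ₀ = 1`** (`Literature.Analysis.Complex.eq_of_anchored_certificate`)
  — the input of an Evans-function certificate (`…OperatorTheory.pencil_rankOne_algebraically_simple`).

Everything here is analysis; "`Re (f/cₖ) > 0` on piece `k`" and an enclosure of `Im (certAnchorSum …)` below `2π`
resp. `4π` are what an interval computation discharges. Source: Henrici 1974 §4.6 Appendix, Thm. 4.10a.
-/

noncomputable section

open Complex Set MeasureTheory intervalIntegral
open scoped Real

namespace Literature.Analysis.Complex

variable {a b c d : ℝ}

/-! ### Anchors and the junction identity -/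

/-- The junction term from anchor `c` to anchor `c'`: the principal logarithm `log (c'/c)` (imaginary part
`Arg (c'/c) ∈ (-π, π]` = the signed angle of the straight step from `c` to `c'` seen from `0`).
[cite: Henrici1974, §4.6 Appendix (4.6-13)] -/
def anchorJump (c c' : ℂ) : ℂ := Complex.log (c' / c)

/-- `Im (anchorJump c c') = Arg (c'/c)`. [cite: Henrici1974, §4.6 Appendix (4.6-13)] -/
@[simp] lemma anchorJump_im (c c' : ℂ) : (anchorJump c c').im = arg (c' / c) := by
  rw [anchorJump, log_im]

/-- **The junction identity.** If `Re (w/c) > 0` and `Re (w/c') > 0` then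
`log (w/c) − log (w/c') = log (c'/c)`: both sides have real part `log |c'| − log |c|`, and imaginary parts
`arg (w/c) − arg (w/c') ∈ (−π, π)`, `Arg (c'/c) ∈ (−π, π]` congruent modulo `2π`, hence equal.
[cite: Henrici1974, §4.6 Appendix (4.6-13)] -/
theorem log_div_sub_log_div_of_re_pos {c c' w : ℂ} (h : 0 < (w / c).re) (h' : 0 < (w / c').re) :
    Complex.log (w / c) - Complex.log (w / c') = anchorJump c c' := by
  have hc : c ≠ 0 := by rintro rfl; simp at h
  have hc' : c' ≠ 0 := by rintro rfl; simp at h'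
  have hw : w ≠ 0 := by rintro rfl; simp at h
  have hau := abs_lt.1 (abs_arg_lt_pi_div_two_iff.2 (Or.inl h))
  have hav := abs_lt.1 (abs_arg_lt_pi_div_two_iff.2 (Or.inl h'))
  have hvπ : arg (w / c') ≠ π := fun hπ ↦ by rw [hπ] at hav; linarith [Real.pi_pos]
  have hratio : c' / c = (w / c) * (w / c')⁻¹ := by field_simp
  have harg_inv : arg (w / c')⁻¹ = -arg (w / c') := by rw [arg_inv, if_neg hvπ]
  have key := (log_mul_eq_add_log_iff (div_ne_zero hw hc) (inv_ne_zero (div_ne_zero hw hc'))).2 (by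
    rw [harg_inv]; constructor <;> linarith [Real.pi_pos])
  rw [anchorJump, hratio, key, log_inv _ hvπ]
  ring

/-- The last endpoint of an anchored piece list started at `x₀`. [cite: Henrici1974, §4.6 Appendix (4.6-13)] -/
@[simp] def apLast (x₀ : ℝ) : List (ℝ × ℂ) → ℝ
  | [] => x₀
  | (x₁, _) :: L => apLast x₁ L

/-- The last anchor of an anchored piece list whose first anchor is `c₀`. [cite: Henrici1974, §4.6 Appendix (4.6-13)] -/
@[simp] def apLastAnchor (c₀ : ℂ) : List (ℝ × ℂ) → ℂ
  | [] => c₀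
  | (_, c₁) :: L => apLastAnchor c₁ L

/-- The sum of the junction terms `log (c_{j+1}/c_j)` of an anchored piece list (first anchor `c₀`).
[cite: Henrici1974, §4.6 Appendix (4.6-13)] -/
@[simp] def apJumps (c₀ : ℂ) : List (ℝ × ℂ) → ℂ
  | [] => 0
  | (_, c₁) :: L => anchorJump c₀ c₁ + apJumps c₁ L

/-- Validity of an anchored piece list along the horizontal line `Im z = y` from `x₀`: the entry `(x₁, c₁)`
closes the piece `[x₀, x₁]` with anchor `c₁`, i.e. `x₀ ≤ x₁` and `Re (f(x + iy)/c₁) > 0` on it.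
[cite: Henrici1974, §4.6 Appendix (4.6-13)] -/
def HAPieces (f : ℂ → ℂ) (y : ℝ) : ℝ → List (ℝ × ℂ) → Prop
  | _, [] => True
  | x₀, (x₁, c₁) :: L =>
      x₀ ≤ x₁ ∧ (∀ x ∈ Icc x₀ x₁, 0 < (f (x + y * I) / c₁).re) ∧ HAPieces f y x₁ L

/-- Validity of an anchored piece list along the vertical line `Re z = x`. [cite: Henrici1974, §4.6 Appendix (4.6-13)] -/
def VAPieces (f : ℂ → ℂ) (x : ℝ) : ℝ → List (ℝ × ℂ) → Prop
  | _, [] => True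
  | y₀, (y₁, c₁) :: L =>
      y₀ ≤ y₁ ∧ (∀ y ∈ Icc y₀ y₁, 0 < (f (x + y * I) / c₁).re) ∧ VAPieces f x y₁ L

/-- The endpoints of a valid horizontal anchored piece list increase. [cite: Henrici1974, §4.6 Appendix (4.6-13)] -/
lemma HAPieces.le_apLast {f : ℂ → ℂ} {y : ℝ} :
    ∀ {x₀ : ℝ} {L : List (ℝ × ℂ)}, HAPieces f y x₀ L → x₀ ≤ apLast x₀ L
  | _, [], _ => le_rfl
  | _, (_, _) :: _, h => h.1.trans (HAPieces.le_apLast h.2.2)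

/-- The endpoints of a valid vertical anchored piece list increase. [cite: Henrici1974, §4.6 Appendix (4.6-13)] -/
lemma VAPieces.le_apLast {f : ℂ → ℂ} {x : ℝ} :
    ∀ {y₀ : ℝ} {L : List (ℝ × ℂ)}, VAPieces f x y₀ L → y₀ ≤ apLast y₀ L
  | _, [], _ => le_rfl
  | _, (_, _) :: _, h => h.1.trans (VAPieces.le_apLast h.2.2)

/-- On a valid horizontal anchored piece list, `f ≠ 0` along the whole segment. [cite: Henrici1974, §4.6 Appendix (4.6-13)] -/
lemma HAPieces.ne_zero {f : ℂ → ℂ} {y : ℝ} :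
    ∀ {x₀ : ℝ} {L : List (ℝ × ℂ)}, HAPieces f y x₀ L →
      ∀ x ∈ Icc x₀ (apLast x₀ L), L ≠ [] → f (x + y * I) ≠ 0
  | _, [], _, _, _, h => (h rfl).elim
  | x₀, (x₁, c₁) :: L, h, x, hx, _ => by
    rcases le_or_gt x x₁ with hle | hgt
    · intro h0
      have := h.2.1 x ⟨hx.1, hle⟩
      simp [h0] at this
    · rcases L with _ | ⟨⟨x₂, c₂⟩, L'⟩
      · simp at hx; linarith
      · exact HAPieces.ne_zero h.2.2 x ⟨hgt.le, by simpa using hx.2⟩ (by simp)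

/-- On a valid vertical anchored piece list, `f ≠ 0` along the whole segment. [cite: Henrici1974, §4.6 Appendix (4.6-13)] -/
lemma VAPieces.ne_zero {f : ℂ → ℂ} {x : ℝ} :
    ∀ {y₀ : ℝ} {L : List (ℝ × ℂ)}, VAPieces f x y₀ L →
      ∀ y ∈ Icc y₀ (apLast y₀ L), L ≠ [] → f (x + y * I) ≠ 0
  | _, [], _, _, _, h => (h rfl).elim
  | y₀, (y₁, c₁) :: L, h, y, hy, _ => by
    rcases le_or_gt y y₁ with hle | hgt
    · intro h0
      have := h.2.1 y ⟨hy.1, hle⟩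
      simp [h0] at this
    · rcases L with _ | ⟨⟨y₂, c₂⟩, L'⟩
      · simp at hy; linarith
      · exact VAPieces.ne_zero h.2.2 y ⟨hgt.le, by simpa using hy.2⟩ (by simp)

/-- The first-piece condition at the left endpoint. [cite: Henrici1974, §4.6 Appendix (4.6-13)] -/
lemma HAPieces.re_pos_head {f : ℂ → ℂ} {y x₀ x₁ : ℝ} {c₁ : ℂ} {L : List (ℝ × ℂ)}
    (h : HAPieces f y x₀ ((x₁, c₁) :: L)) : 0 < (f (x₀ + y * I) / c₁).re :=
  h.2.1 x₀ ⟨le_rfl, h.1⟩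

/-- The first-piece condition at the bottom endpoint (vertical). [cite: Henrici1974, §4.6 Appendix (4.6-13)] -/
lemma VAPieces.re_pos_head {f : ℂ → ℂ} {x y₀ y₁ : ℝ} {c₁ : ℂ} {L : List (ℝ × ℂ)}
    (h : VAPieces f x y₀ ((y₁, c₁) :: L)) : 0 < (f (x + y₀ * I) / c₁).re :=
  h.2.1 y₀ ⟨le_rfl, h.1⟩

/-- The last-piece condition at the right endpoint. [cite: Henrici1974, §4.6 Appendix (4.6-13)] -/
lemma HAPieces.re_pos_last {f : ℂ → ℂ} {y : ℝ} :
    ∀ {x₀ x₁ : ℝ} {c₁ : ℂ} {L : List (ℝ × ℂ)}, HAPieces f y x₀ ((x₁, c₁) :: L) →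
      0 < (f (apLast x₁ L + y * I) / apLastAnchor c₁ L).re
  | x₀, x₁, c₁, [], h => by simpa using h.2.1 x₁ ⟨h.1, le_rfl⟩
  | x₀, x₁, c₁, (x₂, c₂) :: L, h => by
    simpa using HAPieces.re_pos_last (x₀ := x₁) h.2.2

/-- The last-piece condition at the top endpoint (vertical). [cite: Henrici1974, §4.6 Appendix (4.6-13)] -/
lemma VAPieces.re_pos_last {f : ℂ → ℂ} {x : ℝ} :
    ∀ {y₀ y₁ : ℝ} {c₁ : ℂ} {L : List (ℝ × ℂ)}, VAPieces f x y₀ ((y₁, c₁) :: L) →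
      0 < (f (x + apLast y₁ L * I) / apLastAnchor c₁ L).re
  | y₀, y₁, c₁, [], h => by simpa using h.2.1 y₁ ⟨h.1, le_rfl⟩
  | y₀, y₁, c₁, (y₂, c₂) :: L, h => by
    simpa using VAPieces.re_pos_last (y₀ := y₁) h.2.2

/-- Log-derivative of `f/c₀` is that of `f`. [folklore] -/
private lemma deriv_div_const_div {f : ℂ → ℂ} {c₀ : ℂ} (hc0 : c₀ ≠ 0) (z : ℂ) :
    deriv (fun w ↦ f w / c₀) z / (f z / c₀) = deriv f z / f z := by
  rw [deriv_div_const, div_div_div_cancel_right₀ hc0]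

/-- One anchored horizontal piece: `∫_{x₀}^{x₁} f'/f = log (f(x₁+iy)/c₀) - log (f(x₀+iy)/c₀)`.
[cite: Henrici1974, §4.6 Appendix (4.6-13)] -/
lemma integral_logDeriv_hapiece {f : ℂ → ℂ} {y x₀ x₁ : ℝ} {c₀ : ℂ} (h01 : x₀ ≤ x₁)
    (hf : ∀ x ∈ Icc x₀ x₁, AnalyticAt ℂ f (x + y * I))
    (hc : ∀ x ∈ Icc x₀ x₁, 0 < (f (x + y * I) / c₀).re) :
    ∫ x : ℝ in x₀..x₁, deriv f (x + y * I) / f (x + y * I) =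
      Complex.log (f (x₁ + y * I) / c₀) - Complex.log (f (x₀ + y * I) / c₀) := by
  have hc0 : c₀ ≠ 0 := fun h0 ↦ by have := hc x₀ ⟨le_rfl, h01⟩; simp [h0] at this
  have h := integral_logDeriv_horizontal (g := fun w ↦ f w / c₀) y h01
    (fun x hx ↦ (hf x hx).div analyticAt_const hc0) (fun x hx ↦ Or.inl (hc x hx))
  rw [intervalIntegral.integral_congr (fun x _ ↦ deriv_div_const_div hc0 _)] at h
  exact h

/-- One anchored vertical piece. [cite: Henrici1974, §4.6 Appendix (4.6-13)] -/
lemma integral_logDeriv_vapiece {f : ℂ → ℂ} {x y₀ y₁ : ℝ} {c₀ : ℂ} (h01 : y₀ ≤ y₁)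
    (hf : ∀ y ∈ Icc y₀ y₁, AnalyticAt ℂ f (x + y * I))
    (hc : ∀ y ∈ Icc y₀ y₁, 0 < (f (x + y * I) / c₀).re) :
    I * ∫ y : ℝ in y₀..y₁, deriv f (x + y * I) / f (x + y * I) =
      Complex.log (f (x + y₁ * I) / c₀) - Complex.log (f (x + y₀ * I) / c₀) := by
  have hc0 : c₀ ≠ 0 := fun h0 ↦ by have := hc y₀ ⟨le_rfl, h01⟩; simp [h0] at this
  have h := integral_logDeriv_vertical (g := fun w ↦ f w / c₀) x h01
    (fun y hy ↦ (hf y hy).div analyticAt_const hc0) (fun y hy ↦ Or.inl (hc y hy))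
  rw [intervalIntegral.integral_congr (fun y _ ↦ deriv_div_const_div hc0 _)] at h
  exact h

/-- **Exact integral along an anchored horizontal edge**:
`∫_{x₀}^{last} f'/f(x+iy) dx = log (f(last+iy)/c_last) - log (f(x₀+iy)/c₁) + Σ junction terms`.
[cite: Henrici1974, §4.6 Appendix (4.6-13)] -/
theorem integral_logDeriv_hapieces {f : ℂ → ℂ} {y : ℝ} :
    ∀ {x₀ x₁ : ℝ} {c₁ : ℂ} {L : List (ℝ × ℂ)}, HAPieces f y x₀ ((x₁, c₁) :: L) →
      (∀ x ∈ Icc x₀ (apLast x₁ L), AnalyticAt ℂ f (x + y * I)) →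
      ∫ x : ℝ in x₀..apLast x₁ L, deriv f (x + y * I) / f (x + y * I) =
        Complex.log (f (apLast x₁ L + y * I) / apLastAnchor c₁ L) -
          Complex.log (f (x₀ + y * I) / c₁) + apJumps c₁ L
  | x₀, x₁, c₁, [], h, hf => by
    simp only [apLast, apLastAnchor, apJumps, add_zero]
    exact integral_logDeriv_hapiece h.1 (by simpa using hf) h.2.1
  | x₀, x₁, c₁, (x₂, c₂) :: L, h, hf => by
    have h1 : x₀ ≤ x₁ := h.1
    have htail : HAPieces f y x₁ ((x₂, c₂) :: L) := h.2.2
    have h2 : x₁ ≤ apLast x₂ L := by simpa using htail.le_apLast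
    have hf1 : ∀ x ∈ Icc x₀ x₁, AnalyticAt ℂ f (x + y * I) := fun x hx ↦
      hf x ⟨hx.1, hx.2.trans (by simpa using h2)⟩
    have hf2 : ∀ x ∈ Icc x₁ (apLast x₂ L), AnalyticAt ℂ f (x + y * I) := fun x hx ↦
      hf x ⟨h1.trans hx.1, by simpa using hx.2⟩
    have ih := integral_logDeriv_hapieces htail hf2
    have hpiece := integral_logDeriv_hapiece h1 hf1 h.2.1
    have hjunction := log_div_sub_log_div_of_re_pos (h.2.1 x₁ ⟨h1, le_rfl⟩) htail.re_pos_head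
    simp only [apLast, apLastAnchor, apJumps]
    rw [← integral_add_adjacent_intervals (b := x₁)
        (intervalIntegrable_logDeriv_horizontal h1 hf1 (fun x hx h0 ↦ by
          have := h.2.1 x hx; simp [h0] at this))
        (intervalIntegrable_logDeriv_horizontal h2 hf2 (fun x hx ↦
          htail.ne_zero x (by simpa using hx) (by simp))),
      hpiece, ih]
    linear_combination hjunction

/-- **Exact integral along an anchored vertical edge**. [cite: Henrici1974, §4.6 Appendix (4.6-13)] -/
theorem integral_logDeriv_vapieces {f : ℂ → ℂ} {x : ℝ} :
    ∀ {y₀ y₁ : ℝ} {c₁ : ℂ} {L : List (ℝ × ℂ)}, VAPieces f x y₀ ((y₁, c₁) :: L) →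
      (∀ y ∈ Icc y₀ (apLast y₁ L), AnalyticAt ℂ f (x + y * I)) →
      I * ∫ y : ℝ in y₀..apLast y₁ L, deriv f (x + y * I) / f (x + y * I) =
        Complex.log (f (x + apLast y₁ L * I) / apLastAnchor c₁ L) -
          Complex.log (f (x + y₀ * I) / c₁) + apJumps c₁ L
  | y₀, y₁, c₁, [], h, hf => by
    simp only [apLast, apLastAnchor, apJumps, add_zero]
    exact integral_logDeriv_vapiece h.1 (by simpa using hf) h.2.1
  | y₀, y₁, c₁, (y₂, c₂) :: L, h, hf => by
    have h1 : y₀ ≤ y₁ := h.1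
    have htail : VAPieces f x y₁ ((y₂, c₂) :: L) := h.2.2
    have h2 : y₁ ≤ apLast y₂ L := by simpa using htail.le_apLast
    have hf1 : ∀ y ∈ Icc y₀ y₁, AnalyticAt ℂ f (x + y * I) := fun y hy ↦
      hf y ⟨hy.1, hy.2.trans (by simpa using h2)⟩
    have hf2 : ∀ y ∈ Icc y₁ (apLast y₂ L), AnalyticAt ℂ f (x + y * I) := fun y hy ↦
      hf y ⟨h1.trans hy.1, by simpa using hy.2⟩
    have ih := integral_logDeriv_vapieces htail hf2
    have hpiece := integral_logDeriv_vapiece h1 hf1 h.2.1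
    have hjunction := log_div_sub_log_div_of_re_pos (h.2.1 y₁ ⟨h1, le_rfl⟩) htail.re_pos_head
    simp only [apLast, apLastAnchor, apJumps]
    rw [← integral_add_adjacent_intervals (b := y₁)
        (intervalIntegrable_logDeriv_vertical h1 hf1 (fun y hy h0 ↦ by
          have := h.2.1 y hy; simp [h0] at this))
        (intervalIntegrable_logDeriv_vertical h2 hf2 (fun y hy ↦
          htail.ne_zero y (by simpa using hy) (by simp))),
      mul_add, hpiece, ih]
    linear_combination hjunction

/-! #### The anchored certificate -/

/-- The total junction sum of an anchored rectangle certificate, read counter-clockwise (bottom left to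
right, corner, right upwards, corner, top right to left = minus its left-to-right terms, corner, left
downwards, corner); depends on the anchors only (`2πi ·` winding number of the anchor polygon).
[cite: Henrici1974, §4.6 Appendix (4.6-13)–(4.6-14) with Thm. 4.10a] -/
def certAnchorSum (cB : ℂ) (LB : List (ℝ × ℂ)) (cR : ℂ) (LR : List (ℝ × ℂ)) (cT : ℂ)
    (LT : List (ℝ × ℂ)) (cL : ℂ) (LL : List (ℝ × ℂ)) : ℂ :=
  apJumps cB LB + anchorJump (apLastAnchor cB LB) cR + apJumps cR LR +
    anchorJump (apLastAnchor cR LR) (apLastAnchor cT LT) - apJumps cT LT +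
    anchorJump cT (apLastAnchor cL LL) - apJumps cL LL + anchorJump cL cB

/-- **The boundary integral from an anchored certificate.** Let `f` be analytic at every point of the
closed rectangle `[a,b] × [c,d]`, and let the four edges carry valid anchored piece lists (bottom and top
edges listed from `x = a` to `x = b`, left and right edges from `y = c` to `y = d`). Then
`∮_{∂K} f'/f = certAnchorSum …`. [cite: Henrici1974, §4.6 Appendix (4.6-13)–(4.6-14) with Thm. 4.10a] -/
theorem rectBoundaryIntegral_logDeriv_eq_anchorSum {f : ℂ → ℂ}
    (hf : AnalyticOnNhd ℂ f (Icc a b ×ℂ Icc c d))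
    {xB : ℝ} {cB : ℂ} {LB : List (ℝ × ℂ)} (hB : HAPieces f c a ((xB, cB) :: LB))
    (hBe : apLast xB LB = b)
    {yR : ℝ} {cR : ℂ} {LR : List (ℝ × ℂ)} (hR : VAPieces f b c ((yR, cR) :: LR))
    (hRe : apLast yR LR = d)
    {xT : ℝ} {cT : ℂ} {LT : List (ℝ × ℂ)} (hT : HAPieces f d a ((xT, cT) :: LT))
    (hTe : apLast xT LT = b)
    {yL : ℝ} {cL : ℂ} {LL : List (ℝ × ℂ)} (hL : VAPieces f a c ((yL, cL) :: LL))
    (hLe : apLast yL LL = d) :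
    rectBoundaryIntegral (fun z ↦ deriv f z / f z) a b c d =
      certAnchorSum cB LB cR LR cT LT cL LL := by
  have hab : a ≤ b := by rw [← hBe]; exact hB.le_apLast
  have hcd : c ≤ d := by rw [← hRe]; exact hR.le_apLast
  have hfB : ∀ x ∈ Icc a (apLast xB LB), AnalyticAt ℂ f (x + c * I) := fun x hx ↦
    hf _ ⟨by simpa [hBe] using hx, by simpa using hcd⟩
  have hfT : ∀ x ∈ Icc a (apLast xT LT), AnalyticAt ℂ f (x + d * I) := fun x hx ↦
    hf _ ⟨by simpa [hTe] using hx, by simpa using hcd⟩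
  have hfR : ∀ y ∈ Icc c (apLast yR LR), AnalyticAt ℂ f (b + y * I) := fun y hy ↦
    hf _ ⟨by simpa using hab, by simpa [hRe] using hy⟩
  have hfL : ∀ y ∈ Icc c (apLast yL LL), AnalyticAt ℂ f (a + y * I) := fun y hy ↦
    hf _ ⟨by simpa using hab, by simpa [hLe] using hy⟩
  have eB := integral_logDeriv_hapieces hB hfB
  have eT := integral_logDeriv_hapieces hT hfT
  have eR := integral_logDeriv_vapieces hR hfR
  have eL := integral_logDeriv_vapieces hL hfL
  rw [hBe] at eB; rw [hTe] at eT; rw [hRe] at eR; rw [hLe] at eL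
  have pB1 := hB.re_pos_last; rw [hBe] at pB1
  have pR1 := hR.re_pos_last; rw [hRe] at pR1
  have pT1 := hT.re_pos_last; rw [hTe] at pT1
  have pL1 := hL.re_pos_last; rw [hLe] at pL1
  have jBR := log_div_sub_log_div_of_re_pos pB1 hR.re_pos_head
  have jRT := log_div_sub_log_div_of_re_pos pR1 pT1
  have jTL := log_div_sub_log_div_of_re_pos hT.re_pos_head pL1
  have jLB := log_div_sub_log_div_of_re_pos hL.re_pos_head hB.re_pos_head
  rw [rectBoundaryIntegral_def, eB, eT, eR, eL, certAnchorSum]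
  linear_combination jBR + jRT + jTL + jLB

section consequences

variable {f : ℂ → ℂ} {xB : ℝ} {cB : ℂ} {LB : List (ℝ × ℂ)} {yR : ℝ} {cR : ℂ} {LR : List (ℝ × ℂ)}
  {xT : ℝ} {cT : ℂ} {LT : List (ℝ × ℂ)} {yL : ℝ} {cL : ℂ} {LL : List (ℝ × ℂ)}

/-- Bundle: `f ≠ 0` on the four edges and the value of `∮_{∂K} f'/f`, from a certificate. [folklore] -/
private lemma anchored_core (hf : AnalyticOnNhd ℂ f (Icc a b ×ℂ Icc c d))
    (hB : HAPieces f c a ((xB, cB) :: LB)) (hBe : apLast xB LB = b)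
    (hR : VAPieces f b c ((yR, cR) :: LR)) (hRe : apLast yR LR = d)
    (hT : HAPieces f d a ((xT, cT) :: LT)) (hTe : apLast xT LT = b)
    (hL : VAPieces f a c ((yL, cL) :: LL)) (hLe : apLast yL LL = d) :
    (∀ x ∈ Icc a b, f (x + c * I) ≠ 0) ∧ (∀ x ∈ Icc a b, f (x + d * I) ≠ 0) ∧
      (∀ y ∈ Icc c d, f (a + y * I) ≠ 0) ∧ (∀ y ∈ Icc c d, f (b + y * I) ≠ 0) ∧
      rectBoundaryIntegral (fun z ↦ deriv f z / f z) a b c d =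
        certAnchorSum cB LB cR LR cT LT cL LL :=
  ⟨fun x hx ↦ hB.ne_zero x (by simpa [hBe] using hx) (by simp),
    fun x hx ↦ hT.ne_zero x (by simpa [hTe] using hx) (by simp),
    fun y hy ↦ hL.ne_zero y (by simpa [hLe] using hy) (by simp),
    fun y hy ↦ hR.ne_zero y (by simpa [hRe] using hy) (by simp),
    rectBoundaryIntegral_logDeriv_eq_anchorSum hf hB hBe hR hRe hT hTe hL hLe⟩

/-- **`Re = 0` and `Im = 2π · #zeros` for the anchored certificate** (`a < b`, `c < d`): the zeros of `f` in
the open rectangle form a finite set `s` with multiplicities `m ρ = analyticOrderAt f ρ ≥ 1`,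
`Re (certAnchorSum …) = 0` and `Im (certAnchorSum …) = 2π · Σ_{ρ ∈ s} m ρ`.
[cite: Henrici1974, §4.6 Appendix (4.6-13)–(4.6-14) with Thm. 4.10a] -/
theorem exists_count_of_anchored_certificate (hab : a < b) (hcd : c < d)
    (hf : AnalyticOnNhd ℂ f (Icc a b ×ℂ Icc c d))
    (hB : HAPieces f c a ((xB, cB) :: LB)) (hBe : apLast xB LB = b)
    (hR : VAPieces f b c ((yR, cR) :: LR)) (hRe : apLast yR LR = d)
    (hT : HAPieces f d a ((xT, cT) :: LT)) (hTe : apLast xT LT = b)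
    (hL : VAPieces f a c ((yL, cL) :: LL)) (hLe : apLast yL LL = d) :
    ∃ (s : Finset ℂ) (m : ℂ → ℕ), (∀ z, z ∈ s ↔ f z = 0 ∧ z ∈ Ioo a b ×ℂ Ioo c d) ∧
      (∀ ρ ∈ s, 1 ≤ m ρ ∧ analyticOrderAt f ρ = m ρ) ∧
      (certAnchorSum cB LB cR LR cT LT cL LL).re = 0 ∧
      (certAnchorSum cB LB cR LR cT LT cL LL).im = 2 * π * ((∑ ρ ∈ s, m ρ : ℕ) : ℝ) := by
  obtain ⟨h₁, h₂, h₃, h₄, hv⟩ := anchored_core hf hB hBe hR hRe hT hTe hL hLe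
  exact exists_count_im_eq hab hcd hf h₁ h₂ h₃ h₄ hv

/-- **Zero-freeness from an anchored certificate**: if `Im (certAnchorSum …) < 2π` then `f` has no zero
in the open rectangle. [cite: Henrici1974, §4.6 Appendix (4.6-13)–(4.6-14) with Thm. 4.10a] -/
theorem no_zero_of_anchored_certificate (hab : a < b) (hcd : c < d)
    (hf : AnalyticOnNhd ℂ f (Icc a b ×ℂ Icc c d))
    (hB : HAPieces f c a ((xB, cB) :: LB)) (hBe : apLast xB LB = b)
    (hR : VAPieces f b c ((yR, cR) :: LR)) (hRe : apLast yR LR = d)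
    (hT : HAPieces f d a ((xT, cT) :: LT)) (hTe : apLast xT LT = b)
    (hL : VAPieces f a c ((yL, cL) :: LL)) (hLe : apLast yL LL = d)
    (him : (certAnchorSum cB LB cR LR cT LT cL LL).im < 2 * π) :
    ∀ z ∈ Ioo a b ×ℂ Ioo c d, f z ≠ 0 := by
  obtain ⟨h₁, h₂, h₃, h₄, hv⟩ := anchored_core hf hB hBe hR hRe hT hTe hL hLe
  exact no_zero_of_rectBoundaryIntegral_im_lt hab hcd hf h₁ h₂ h₃ h₄ hv him

/-- **A zero from an anchored certificate**: if `Im (certAnchorSum …) ≠ 0` then `f` has a zero in the open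
rectangle. [cite: Henrici1974, §4.6 Appendix (4.6-13)–(4.6-14) with Thm. 4.10a] -/
theorem exists_zero_of_anchored_certificate (hab : a < b) (hcd : c < d)
    (hf : AnalyticOnNhd ℂ f (Icc a b ×ℂ Icc c d))
    (hB : HAPieces f c a ((xB, cB) :: LB)) (hBe : apLast xB LB = b)
    (hR : VAPieces f b c ((yR, cR) :: LR)) (hRe : apLast yR LR = d)
    (hT : HAPieces f d a ((xT, cT) :: LT)) (hTe : apLast xT LT = b)
    (hL : VAPieces f a c ((yL, cL) :: LL)) (hLe : apLast yL LL = d)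
    (him : (certAnchorSum cB LB cR LR cT LT cL LL).im ≠ 0) :
    ∃ z ∈ Ioo a b ×ℂ Ioo c d, f z = 0 := by
  obtain ⟨h₁, h₂, h₃, h₄, hv⟩ := anchored_core hf hB hBe hR hRe hT hTe hL hLe
  exact exists_zero_of_rectBoundaryIntegral_ne_zero hab hcd hf h₁ h₂ h₃ h₄ hv
    (fun h0 ↦ him (by rw [h0]; rfl))

/-- **Exactly one zero from an anchored certificate and a known zero.** If `Im (certAnchorSum …) < 4π` and
`f ρ₀ = 0` for some `ρ₀` in the open rectangle, then `ρ₀` is the only zero of `f` there and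
`analyticOrderAt f ρ₀ = 1` (the input of `Literature.Analysis.OperatorTheory.pencil_rankOne_algebraically_simple`
for Evans functions). [cite: Henrici1974, §4.6 Appendix (4.6-13)–(4.6-14) with Thm. 4.10a] -/
theorem eq_of_anchored_certificate (hab : a < b) (hcd : c < d)
    (hf : AnalyticOnNhd ℂ f (Icc a b ×ℂ Icc c d))
    (hB : HAPieces f c a ((xB, cB) :: LB)) (hBe : apLast xB LB = b)
    (hR : VAPieces f b c ((yR, cR) :: LR)) (hRe : apLast yR LR = d)
    (hT : HAPieces f d a ((xT, cT) :: LT)) (hTe : apLast xT LT = b)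
    (hL : VAPieces f a c ((yL, cL) :: LL)) (hLe : apLast yL LL = d)
    (him : (certAnchorSum cB LB cR LR cT LT cL LL).im < 4 * π)
    {ρ₀ : ℂ} (hρ₀ : ρ₀ ∈ Ioo a b ×ℂ Ioo c d) (hρ₀0 : f ρ₀ = 0) :
    (∀ z ∈ Ioo a b ×ℂ Ioo c d, f z = 0 → z = ρ₀) ∧ analyticOrderAt f ρ₀ = 1 := by
  obtain ⟨h₁, h₂, h₃, h₄, hv⟩ := anchored_core hf hB hBe hR hRe hT hTe hL hLe
  exact ⟨eq_of_rectBoundaryIntegral_im_lt hab hcd hf h₁ h₂ h₃ h₄ hv him hρ₀ hρ₀0,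
    analyticOrderAt_eq_one_of_rectBoundaryIntegral_im_lt hab hcd hf h₁ h₂ h₃ h₄ hv him hρ₀ hρ₀0⟩

end consequences

end Literature.Analysis.Complex

end
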